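import Mathlib
import Summits.AtomisticToContinuum.Crystallization.Theorems.ChessboardParticlePlanesLjLaminarWindowsThickCircleA
import HarnessLib

/-! # Thick-circle count, part B (axial window, sectors, adapted frame, final arithmetic) — stub
`stub_thickCircle` of line `Sketch` (skeleton rev. 14, lead c8), crux `LjLaminarWindows`
(stmt-AtomisticToContinuum-6711) -/

noncomputable section

open scoped BigOperators InnerProductSpace
open Filter Topology
open Literature.MathematicalPhysics.StatisticalMechanics
open Summit.AtomisticToContinuum.Crystallization.Theorems.ChargedEnergyGapNegative

namespace Summit.AtomisticToContinuum.Crystallization.Theorems.LjLaminarWindowsSketch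

/-- **Axial window.** For `a, b ∈ (L - R, L]`, `4R ≤ d ≤ L/2`, `1 ≤ R`, `100 R ≤ L` and
`t = (a² + d² - b²)/(2d)`: `t ∈ (d/2 - LR/d, d/2 + LR/d)` and `|t| ≤ 0.27 L`. [folklore] -/
theorem thickCircle_tbounds {L R d a b t : ℝ} (hR : 1 ≤ R) (hL : 100 * R ≤ L) (hd4 : 4 * R ≤ d)
    (hdL : d ≤ L / 2) (ha1 : L - R < a) (ha2 : a ≤ L) (hb1 : L - R < b) (hb2 : b ≤ L)
    (ht : t = (a ^ 2 + d ^ 2 - b ^ 2) / (2 * d)) :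
    d / 2 - L * R / d < t ∧ t < d / 2 - L * R / d + 2 * L * R / d ∧ |t| ≤ 27 / 100 * L := by
  have hR0 : 0 < R := by linarith
  have hL0 : 0 < L := by linarith
  have hd0 : 0 < d := by linarith
  have ha_sq : (L - R) ^ 2 < a ^ 2 := pow_lt_pow_left₀ ha1 (by linarith) two_ne_zero
  have hb_sq : (L - R) ^ 2 < b ^ 2 := pow_lt_pow_left₀ hb1 (by linarith) two_ne_zero
  have ha_sq' : a ^ 2 ≤ L ^ 2 := pow_le_pow_left₀ (by linarith) ha2 2
  have hb_sq' : b ^ 2 ≤ L ^ 2 := pow_le_pow_left₀ (by linarith) hb2 2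
  have e1 : d / 2 - L * R / d = (d ^ 2 - 2 * L * R) / (2 * d) := by field_simp
  have e2 : d / 2 - L * R / d + 2 * L * R / d = (d ^ 2 + 2 * L * R) / (2 * d) := by field_simp; ring
  have h1 : d / 2 - L * R / d < t := by
    rw [e1, ht]
    exact div_lt_div_of_pos_right (by nlinarith) (by linarith)
  have h2 : t < d / 2 - L * R / d + 2 * L * R / d := by
    rw [e2, ht]
    exact div_lt_div_of_pos_right (by nlinarith) (by linarith)
  refine ⟨h1, h2, ?_⟩
  -- `|t| ≤ 0.27 L`: `-L/4 ≤ -LR/d ≤ d/2 - LR/d` and `d/2 + LR/d ≤ 0.27 L` on `[4R, L/2]`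
  have hlo : -(27 / 100 * L) ≤ d / 2 - L * R / d := by
    rw [e1, le_div_iff₀ (by linarith)]
    nlinarith [mul_le_mul_of_nonneg_left hd4 hL0.le]
  have hhi : d / 2 - L * R / d + 2 * L * R / d ≤ 27 / 100 * L := by
    rw [e2, div_le_iff₀ (by linarith)]
    have hq : (d - 4 * R) * (d - L / 2) ≤ 0 :=
      mul_nonpos_of_nonneg_of_nonpos (by linarith) (by linarith)
    nlinarith [mul_le_mul_of_nonneg_left hL hd0.le]
  rw [abs_le]
  constructor <;> linarith

/-- **Radius of the axial projection.** In a Parseval frame `(e, n, g)`: if `L - R < ‖w‖ ≤ L` and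
`|⟪w, e⟫| ≤ 0.27 L` then `(0.95 L)² ≤ ⟪w, n⟫² + ⟪w, g⟫² ≤ L²`. [folklore] -/
theorem thickCircle_rho (e n g : E3)
    (hP : ∀ w : E3, ⟪w, e⟫_ℝ ^ 2 + ⟪w, n⟫_ℝ ^ 2 + ⟪w, g⟫_ℝ ^ 2 = ‖w‖ ^ 2)
    {L R : ℝ} (hR : 1 ≤ R) (hL : 100 * R ≤ L) (w : E3) (hw1 : L - R < ‖w‖) (hw2 : ‖w‖ ≤ L)
    (ht : |⟪w, e⟫_ℝ| ≤ 27 / 100 * L) :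
    (19 / 20 * L) ^ 2 ≤ ⟪w, n⟫_ℝ ^ 2 + ⟪w, g⟫_ℝ ^ 2 ∧ ⟪w, n⟫_ℝ ^ 2 + ⟪w, g⟫_ℝ ^ 2 ≤ L ^ 2 := by
  have hL0 : 0 < L := by linarith
  have hPw := hP w
  have ht2 : ⟪w, e⟫_ℝ ^ 2 ≤ (27 / 100 * L) ^ 2 := by
    rw [← sq_abs]
    exact pow_le_pow_left₀ (abs_nonneg _) ht 2
  have hw1sq : (L - R) ^ 2 < ‖w‖ ^ 2 := pow_lt_pow_left₀ hw1 (by linarith) two_ne_zero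
  have hw2sq : ‖w‖ ^ 2 ≤ L ^ 2 := pow_le_pow_left₀ (norm_nonneg _) hw2 2
  have hLR99 : (99 / 100 * L) ^ 2 ≤ (L - R) ^ 2 := pow_le_pow_left₀ (by positivity) (by linarith) 2
  constructor
  · linarith [sq_nonneg ⟪w, e⟫_ℝ, pow_pos hL0 2]
  · linarith [sq_nonneg ⟪w, e⟫_ℝ]

/-- **Sector condition.** In a Parseval frame `(e, n, g)` with `α = D/L`, `D = √(LR)`: if
`φ = arg (⟪w, n⟫ + i⟪w, g⟫)` lies in the sector `k = ⌊(φ + π)/α⌋` with centre `φ_k = -π + (k + ½)α`,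
then in the rotated frame `n_k = cos φ_k n + sin φ_k g`, `g_k = -sin φ_k n + cos φ_k g` one has
`⟪w, n_k⟫ > 0` and `|⟪w, g_k⟫| ≤ D/2` (`|sin x| ≤ |x|`, `|φ - φ_k| ≤ α/2`, radius `≤ L`). [folklore] -/
theorem thickCircle_sector (e n g : E3)
    (hP : ∀ w : E3, ⟪w, e⟫_ℝ ^ 2 + ⟪w, n⟫_ℝ ^ 2 + ⟪w, g⟫_ℝ ^ 2 = ‖w‖ ^ 2)
    {L R : ℝ} (hR : 1 ≤ R) (hL : 100 * R ≤ L) (w : E3) (hw1 : L - R < ‖w‖) (hw2 : ‖w‖ ≤ L)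
    (ht : |⟪w, e⟫_ℝ| ≤ 27 / 100 * L) (k : ℕ)
    (hk : k = ⌊(Complex.arg ⟨⟪w, n⟫_ℝ, ⟪w, g⟫_ℝ⟩ + Real.pi) / (Real.sqrt (L * R) / L)⌋₊) :
    0 < ⟪w, Real.cos (-Real.pi + ((k : ℝ) + 1 / 2) * (Real.sqrt (L * R) / L)) • n +
          Real.sin (-Real.pi + ((k : ℝ) + 1 / 2) * (Real.sqrt (L * R) / L)) • g⟫_ℝ ∧
      |⟪w, -Real.sin (-Real.pi + ((k : ℝ) + 1 / 2) * (Real.sqrt (L * R) / L)) • n +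
          Real.cos (-Real.pi + ((k : ℝ) + 1 / 2) * (Real.sqrt (L * R) / L)) • g⟫_ℝ| ≤
        Real.sqrt (L * R) / 2 := by
  obtain ⟨-, -, hDL⟩ := thickCircle_D hR hL
  obtain ⟨hρ1, hρ2⟩ := thickCircle_rho e n g hP hR hL w hw1 hw2 ht
  set D := Real.sqrt (L * R) with hD
  have hR0 : 0 < R := by linarith
  have hL0 : 0 < L := by linarith
  have hD0 : 0 < D := by rw [hD]; exact Real.sqrt_pos.mpr (by positivity)
  set α := D / L with hα
  have hα0 : 0 < α := div_pos hD0 hL0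
  have hα10 : α ≤ 1 / 10 := by rw [hα, div_le_iff₀ hL0]; linarith
  set φk := -Real.pi + ((k : ℝ) + 1 / 2) * α with hφk
  simp only [inner_add_right, real_inner_smul_right]
  set s := ⟪w, n⟫_ℝ with hs
  set σ := ⟪w, g⟫_ℝ with hσ
  set φ := Complex.arg ⟨s, σ⟩ with hφ
  obtain ⟨hpol1, hpol2⟩ := thickCircle_polar s σ φk
  have hρsq := thickCircle_normSq s σ
  set ρ := ‖(⟨s, σ⟩ : ℂ)‖ with hρ
  have hρ0 : 0 ≤ ρ := norm_nonneg _
  have hρpos : 0 < ρ := by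
    rcases hρ0.lt_or_eq with h1 | h1
    · exact h1
    · exfalso
      rw [← h1] at hρsq
      nlinarith
  have hρL : ρ ≤ L := (pow_le_pow_iff_left₀ hρ0 hL0.le two_ne_zero).mp (by rw [hρsq]; exact hρ2)
  -- `|φ - φk| ≤ α / 2`
  have hφπ : 0 ≤ φ + Real.pi := by linarith [Complex.neg_pi_lt_arg (⟨s, σ⟩ : ℂ)]
  have hk1 : (k : ℝ) ≤ (φ + Real.pi) / α := by rw [hk]; exact Nat.floor_le (div_nonneg hφπ hα0.le)
  have hk2 : (φ + Real.pi) / α < k + 1 := by rw [hk]; exact Nat.lt_floor_add_one _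
  rw [le_div_iff₀ hα0] at hk1
  rw [div_lt_iff₀ hα0] at hk2
  have hd1 : -(α / 2) ≤ φ - φk := by rw [hφk]; linarith
  have hd2 : φ - φk ≤ α / 2 := by rw [hφk]; linarith
  have hcos : 0 < Real.cos (φ - φk) :=
    Real.cos_pos_of_mem_Ioo ⟨by linarith [Real.pi_gt_three], by linarith [Real.pi_gt_three]⟩
  have hsin : |Real.sin (φ - φk)| ≤ α / 2 := Real.abs_sin_le_abs.trans (abs_le.mpr ⟨hd1, hd2⟩)
  constructor
  · rw [hpol1]
    exact mul_pos hρpos hcos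
  · rw [hpol2, abs_mul, abs_of_pos hρpos]
    calc ρ * |Real.sin (φ - φk)| ≤ L * (α / 2) := mul_le_mul hρL hsin (abs_nonneg _) hL0.le
      _ = D / 2 := by rw [hα]; field_simp

/-- **Small balls see few sectors.** In a Parseval frame `(e, n, g)` adapted to a reference vector
`w₀` (`⟪w₀, g⟫ = 0`, `⟪w₀, n⟫ ≥ 0.95 L`): if `r < 0.4 L`, `‖w - w₀‖ ≤ 2r`, `L - R < ‖w‖ ≤ L` and
`|⟪w, e⟫| ≤ 0.27 L`, then `|arg (⟪w, n⟫ + i⟪w, g⟫)| ≤ 4r/L` (Jordan's inequality). [folklore] -/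
theorem thickCircle_smallr (e n g : E3)
    (hP : ∀ w : E3, ⟪w, e⟫_ℝ ^ 2 + ⟪w, n⟫_ℝ ^ 2 + ⟪w, g⟫_ℝ ^ 2 = ‖w‖ ^ 2)
    {L R r : ℝ} (hR : 1 ≤ R) (hL : 100 * R ≤ L) (hr : r < 2 / 5 * L) (w w₀ : E3)
    (hw1 : L - R < ‖w‖) (hw2 : ‖w‖ ≤ L) (ht : |⟪w, e⟫_ℝ| ≤ 27 / 100 * L)
    (hg0 : ⟪w₀, g⟫_ℝ = 0) (hn0 : 19 / 20 * L ≤ ⟪w₀, n⟫_ℝ) (hww : ‖w - w₀‖ ≤ 2 * r) :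
    |Complex.arg ⟨⟪w, n⟫_ℝ, ⟪w, g⟫_ℝ⟩| ≤ 4 * r / L := by
  obtain ⟨hρ1, -⟩ := thickCircle_rho e n g hP hR hL w hw1 hw2 ht
  have hL0 : 0 < L := by linarith
  -- components of `w - w₀`
  have hPd := hP (w - w₀)
  have hdn : |⟪w - w₀, n⟫_ℝ| ≤ ‖w - w₀‖ :=
    abs_le_of_sq_le_sq (by nlinarith [sq_nonneg ⟪w - w₀, e⟫_ℝ, sq_nonneg ⟪w - w₀, g⟫_ℝ])
      (norm_nonneg _)
  have hdg : |⟪w - w₀, g⟫_ℝ| ≤ ‖w - w₀‖ :=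
    abs_le_of_sq_le_sq (by nlinarith [sq_nonneg ⟪w - w₀, e⟫_ℝ, sq_nonneg ⟪w - w₀, n⟫_ℝ])
      (norm_nonneg _)
  rw [inner_sub_left] at hdn hdg
  rw [hg0, sub_zero] at hdg
  set s := ⟪w, n⟫_ℝ with hs
  set σ := ⟪w, g⟫_ℝ with hσ
  have hs0 : 0 < s := by
    have := (abs_le.mp hdn).1
    linarith
  have hσr : |σ| ≤ 2 * r := hdg.trans hww
  have hr0 : 0 ≤ r := by linarith [abs_nonneg σ]
  have hρsq := thickCircle_normSq s σ
  set ρ := ‖(⟨s, σ⟩ : ℂ)‖ with hρ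
  have hρ0 : 0 ≤ ρ := norm_nonneg _
  have hρ95 : 19 / 20 * L ≤ ρ :=
    (pow_le_pow_iff_left₀ (by positivity) hρ0 two_ne_zero).mp (by rw [hρsq]; exact hρ1)
  have hρpos : 0 < ρ := by linarith
  set φ := Complex.arg ⟨s, σ⟩ with hφ
  have hφabs : |φ| ≤ Real.pi / 2 :=
    Complex.abs_arg_le_pi_div_two_iff.mpr (by simpa using hs0.le)
  have hsinφ : Real.sin φ = σ / ρ := by rw [hφ, Complex.sin_arg]
  -- `|sin φ| ≤ 2r / ρ`, Jordan: `(2/π)|φ| ≤ |sin φ|`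
  have hsin_abs : |Real.sin φ| * ρ ≤ 2 * r := by
    rw [hsinφ, abs_div, abs_of_pos hρpos, div_mul_cancel₀ _ hρpos.ne']
    exact hσr
  have hjordan : 2 / Real.pi * |φ| ≤ |Real.sin φ| := by
    rcases le_or_gt 0 φ with h0 | h0
    · rw [abs_of_nonneg h0]
      exact (Real.mul_le_sin h0 (abs_le.mp hφabs).2).trans (le_abs_self _)
    · rw [abs_of_neg h0]
      have h1 := Real.mul_le_sin (neg_nonneg.mpr h0.le) (by linarith [(abs_le.mp hφabs).1])
      rw [Real.sin_neg] at h1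
      exact h1.trans (neg_le_abs _)
  have hpi := Real.pi_lt_d2
  have hpi0 := Real.pi_pos
  -- `|φ| ≤ (π/2) (2r/ρ) ≤ π r / (0.95 L) ≤ 4 r / L`
  have h1 : 2 / Real.pi * |φ| * ρ ≤ 2 * r :=
    (mul_le_mul_of_nonneg_right hjordan hρ0).trans hsin_abs
  rw [le_div_iff₀ hL0]
  have h2 : 2 / Real.pi * |φ| * ρ = |φ| * ρ * (2 / Real.pi) := by ring
  rw [h2, ← le_div_iff₀ (by positivity)] at h1
  have h3 : 2 * r / (2 / Real.pi) = Real.pi * r := by field_simp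
  rw [h3] at h1
  nlinarith [abs_nonneg φ, mul_le_mul_of_nonneg_left hρ95 (abs_nonneg φ)]

/-- **Adapted Parseval frame.** For a unit vector `e` and a reference vector `w₀` with
`L - R < ‖w₀‖ ≤ L`, `|⟪w₀, e⟫| ≤ 0.27 L` there are `n, g` with `(e, n, g)` a Parseval frame,
`⟪w₀, g⟫ = 0` and `⟪w₀, n⟫ ≥ 0.95 L`: extend `e` to an orthonormal basis and rotate the last two
vectors by `arg` of the projection of `w₀`. [folklore] -/
theorem thickCircle_frame {L R : ℝ} (hR : 1 ≤ R) (hL : 100 * R ≤ L) (e w₀ : E3) (he : ‖e‖ = 1)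
    (hw1 : L - R < ‖w₀‖) (hw2 : ‖w₀‖ ≤ L) (ht : |⟪w₀, e⟫_ℝ| ≤ 27 / 100 * L) :
    ∃ n g : E3, (∀ w : E3, ⟪w, e⟫_ℝ ^ 2 + ⟪w, n⟫_ℝ ^ 2 + ⟪w, g⟫_ℝ ^ 2 = ‖w‖ ^ 2) ∧
      ⟪w₀, g⟫_ℝ = 0 ∧ 19 / 20 * L ≤ ⟪w₀, n⟫_ℝ := by
  have hL0 : 0 < L := by linarith
  -- an orthonormal basis `b` with `b 0 = e`
  have hcard : Module.finrank ℝ E3 = Fintype.card (Fin 3) := by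
    rw [finrank_euclideanSpace_fin, Fintype.card_fin]
  haveI : Subsingleton (↥({0} : Set (Fin 3))) :=
    (Set.subsingleton_coe _).2 Set.subsingleton_singleton
  have hon : Orthonormal ℝ (({0} : Set (Fin 3)).restrict fun _ : Fin 3 => e) := by
    rw [orthonormal_subsingleton_iff]
    intro i
    exact he
  obtain ⟨b, hb⟩ := Orthonormal.exists_orthonormalBasis_extension_of_card_eq hcard hon
  have hb0 : b 0 = e := hb 0 rfl
  have hPb : ∀ w : E3, ⟪w, e⟫_ℝ ^ 2 + ⟪w, b 1⟫_ℝ ^ 2 + ⟪w, b 2⟫_ℝ ^ 2 = ‖w‖ ^ 2 := by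
    intro w
    have h := b.sum_inner_mul_inner w w
    rw [Fin.sum_univ_three, hb0, real_inner_self_eq_norm_sq, real_inner_comm w e,
      real_inner_comm w (b 1), real_inner_comm w (b 2)] at h
    linear_combination h
  set S₀ := ⟪w₀, b 1⟫_ℝ with hS₀
  set T₀ := ⟪w₀, b 2⟫_ℝ with hT₀
  set ψ₀ := Complex.arg ⟨S₀, T₀⟩ with hψ₀
  refine ⟨Real.cos ψ₀ • b 1 + Real.sin ψ₀ • b 2, -Real.sin ψ₀ • b 1 + Real.cos ψ₀ • b 2,
    thickCircle_parseval_rotate e (b 1) (b 2) hPb ψ₀, ?_, ?_⟩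
  · simp only [inner_add_right, real_inner_smul_right]
    rw [(thickCircle_polar S₀ T₀ ψ₀).2, sub_self, Real.sin_zero, mul_zero]
  · simp only [inner_add_right, real_inner_smul_right]
    rw [(thickCircle_polar S₀ T₀ ψ₀).1, sub_self, Real.cos_zero, mul_one]
    obtain ⟨hρ1, -⟩ := thickCircle_rho e (b 1) (b 2) hPb hR hL w₀ hw1 hw2 ht
    have hρsq := thickCircle_normSq S₀ T₀
    exact (pow_le_pow_iff_left₀ (by positivity) (norm_nonneg _) two_ne_zero).mp
      (by rw [hρsq]; exact hρ1)

/-- **Sector count.** With `D = √(LR)`, `α = D/L`: the sector indices `⌊(φ + π)/α⌋` of the angles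
that can occur form a set `Ks` with `#Ks · D ≤ 16 (r + D)` — all `⌊2π/α⌋ + 1 ≤ 2πL/D + 1` sectors
if `r ≥ 0.4 L` (then `L ≤ 2.5 r`), and the `≤ 8r/D + 2` sectors of the angles `|φ| ≤ 4r/L`
otherwise. [folklore] -/
theorem thickCircle_sectorCount {L R r : ℝ} (hR : 1 ≤ R) (hL : 100 * R ≤ L) (hr : 0 ≤ r) :
    ∃ Ks : Finset ℕ, (Ks.card : ℝ) * Real.sqrt (L * R) ≤ 16 * (r + Real.sqrt (L * R)) ∧
      ∀ φ : ℝ, -Real.pi < φ → φ ≤ Real.pi → (r < 2 / 5 * L → |φ| ≤ 4 * r / L) →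
        ⌊(φ + Real.pi) / (Real.sqrt (L * R) / L)⌋₊ ∈ Ks := by
  obtain ⟨-, hD10, -⟩ := thickCircle_D hR hL
  set D := Real.sqrt (L * R) with hD
  have hR0 : 0 < R := by linarith
  have hL0 : 0 < L := by linarith
  have hD0 : 0 < D := by linarith
  set α := D / L with hα
  have hα0 : 0 < α := div_pos hD0 hL0
  have hLα : α * L = D := by rw [hα]; field_simp
  have hpi := Real.pi_lt_d2
  have hpi3 := Real.pi_gt_three
  by_cases hr4 : r < 2 / 5 * L
  · -- small ball: the sectors between `⌊(π - Φ)/α⌋` and `⌊(π + Φ)/α⌋`, `Φ = 4r/L`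
    set Φ := 4 * r / L with hΦ
    have hΦ0 : 0 ≤ Φ := by positivity
    have hΦL : Φ * L = 4 * r := by rw [hΦ]; field_simp
    have hΦπ : Φ ≤ Real.pi := by
      rw [hΦ, div_le_iff₀ hL0]
      nlinarith
    refine ⟨Finset.Icc ⌊(Real.pi - Φ) / α⌋₊ ⌊(Real.pi + Φ) / α⌋₊, ?_, ?_⟩
    · rw [Nat.card_Icc]
      set klo := ⌊(Real.pi - Φ) / α⌋₊ with hklo_def
      set khi := ⌊(Real.pi + Φ) / α⌋₊ with hkhi_def
      have hkhi : (khi : ℝ) ≤ (Real.pi + Φ) / α := Nat.floor_le (by positivity)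
      have hklo : (Real.pi - Φ) / α < klo + 1 := Nat.lt_floor_add_one _
      rw [le_div_iff₀ hα0] at hkhi
      rw [div_lt_iff₀ hα0] at hklo
      rcases le_or_gt klo (khi + 1) with hle | hlt
      · rw [Nat.cast_sub hle]
        push_cast
        have h1 : ((khi : ℝ) + 1 - klo) * α ≤ 2 * Φ + 2 * α := by linarith
        calc ((khi : ℝ) + 1 - klo) * D = ((khi : ℝ) + 1 - klo) * α * L := by rw [← hLα]; ring
          _ ≤ (2 * Φ + 2 * α) * L := mul_le_mul_of_nonneg_right h1 hL0.le
          _ = 8 * r + 2 * D := by linear_combination 2 * hΦL + 2 * hLα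
          _ ≤ 16 * (r + D) := by linarith
      · rw [Nat.sub_eq_zero_of_le hlt.le, Nat.cast_zero, zero_mul]
        positivity
    · intro φ _ _ hsmall
      have hφ := abs_le.mp (hsmall hr4)
      rw [Finset.mem_Icc]
      exact ⟨Nat.floor_le_floor (div_le_div_of_nonneg_right (by linarith [hφ.1]) hα0.le),
        Nat.floor_le_floor (div_le_div_of_nonneg_right (by linarith [hφ.2]) hα0.le)⟩
  · -- large ball: all sectors
    rw [not_lt] at hr4
    refine ⟨Finset.range (⌊2 * Real.pi / α⌋₊ + 1), ?_, ?_⟩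
    · rw [Finset.card_range]
      push_cast
      have h1 : (⌊2 * Real.pi / α⌋₊ : ℝ) ≤ 2 * Real.pi / α := Nat.floor_le (by positivity)
      rw [le_div_iff₀ hα0] at h1
      calc ((⌊2 * Real.pi / α⌋₊ : ℝ) + 1) * D = (⌊2 * Real.pi / α⌋₊ : ℝ) * α * L + D := by
            rw [← hLα]; ring
        _ ≤ 2 * Real.pi * L + D := by nlinarith [mul_le_mul_of_nonneg_right h1 hL0.le]
        _ ≤ 16 * (r + D) := by nlinarith
    · intro φ _ hφ2 _
      rw [Finset.mem_range]
      exact Nat.lt_succ_of_le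
        (Nat.floor_le_floor (div_le_div_of_nonneg_right (by linarith) hα0.le))

/-- **Final arithmetic** of the thick-circle count: rows `K < W/h + 1` (`W = 2LR/d`,
`h = min D W`), sectors `#Ks · D ≤ 16 (r + D)`, and the per-cell bound multiply to at most
`10⁴ (r + D) R² (L/d + 1)` (narrow case `W ≤ D`: one row, `≤ 1384 (r+D) R² (L/d+1)`; wide case:
`K < 4D/d`, `≤ 3122 (r+D) R² L/d`). [folklore] -/
theorem thickCircle_final :
    ∀ {L R D d r W h C : ℝ} {K : ℕ}, 1 ≤ R → 100 * R ≤ L → D ^ 2 = L * R → 10 * R ≤ D →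
      4 * R ≤ d → 0 ≤ r → W = 2 * L * R / d → h = min D W → (K : ℝ) < W / h + 1 → 0 ≤ C →
      C * D ≤ 16 * (r + D) →
      (K : ℝ) * C * ((7 / 2 * h + 7 / 2 * R + 1) * (5 / 2 * D + 1) * (15 / 4 * R + 1)) ≤
        10000 * (r + D) * R ^ 2 * (L / d + 1) := by
  intro L R D d r W h C K hR hL hDsq hD10 hd4 hr hW hh hK hC0 hC
  have hR0 : 0 < R := by linarith
  have hL0 : 0 < L := by linarith
  have hd0 : 0 < d := by linarith
  have hD0 : 0 < D := by linarith
  have hDne : D ≠ 0 := hD0.ne'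
  have hdne : d ≠ 0 := hd0.ne'
  have hW0 : 0 < W := by rw [hW]; positivity
  have hCle : C ≤ 16 * (r + D) / D := by rw [le_div_iff₀ hD0]; exact hC
  have h52 : 5 / 2 * D + 1 ≤ 13 / 5 * D := by linarith
  have h154 : 15 / 4 * R + 1 ≤ 19 / 4 * R := by linarith
  have hX : 0 ≤ (r + D) * R ^ 2 * (L / d + 1) := by positivity
  have hh0 : 0 < h := by rw [hh]; exact lt_min hD0 hW0
  have hM0 : 0 ≤ (7 / 2 * h + 7 / 2 * R + 1) * (5 / 2 * D + 1) * (15 / 4 * R + 1) := by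
    apply mul_nonneg (mul_nonneg ?_ ?_) ?_ <;> linarith
  rcases le_or_gt W D with hWD | hDW
  · -- narrow: `h = W`, one row
    have hhW : h = W := by rw [hh, min_eq_right hWD]
    have hK1 : (K : ℝ) ≤ 1 := by
      rw [hhW, div_self hW0.ne'] at hK
      have h2 : K < 2 := by exact_mod_cast (show (K : ℝ) < 2 by linarith)
      exact_mod_cast Nat.lt_succ_iff.mp h2
    have hM1 : 7 / 2 * h + 7 / 2 * R + 1 ≤ 7 * R * (L / d + 1) := by
      have e1 : 7 * R * (L / d + 1) = 7 / 2 * W + 7 * R := by rw [hW]; ring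
      rw [e1, hhW]
      linarith
    have step1 : (K : ℝ) * C ≤ 1 * (16 * (r + D) / D) := mul_le_mul hK1 hCle hC0 zero_le_one
    have step2 : (7 / 2 * h + 7 / 2 * R + 1) * (5 / 2 * D + 1) * (15 / 4 * R + 1) ≤
        7 * R * (L / d + 1) * (13 / 5 * D) * (19 / 4 * R) :=
      mul_le_mul (mul_le_mul hM1 h52 (by positivity) (by positivity)) h154 (by positivity)
        (by positivity)
    calc (K : ℝ) * C * ((7 / 2 * h + 7 / 2 * R + 1) * (5 / 2 * D + 1) * (15 / 4 * R + 1))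
        ≤ 1 * (16 * (r + D) / D) * (7 * R * (L / d + 1) * (13 / 5 * D) * (19 / 4 * R)) :=
          mul_le_mul step1 step2 hM0 (by positivity)
      _ = 16 * 7 * (13 / 5) * (19 / 4) * ((r + D) * R ^ 2 * (L / d + 1)) := by
          field_simp
      _ ≤ 10000 * (r + D) * R ^ 2 * (L / d + 1) := by nlinarith [hX]
  · -- wide: `h = D`, `K < 4D/d`
    have hhD : h = D := by rw [hh, min_eq_left hDW.le]
    have e1 : W / D = 2 * D / d := by
      rw [div_eq_div_iff hDne hdne, hW, div_mul_cancel₀ _ hdne]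
      linear_combination -2 * hDsq
    have hK4 : (K : ℝ) ≤ 4 * D / d := by
      rw [hhD, e1] at hK
      have h1 : 1 < W / D := (one_lt_div hD0).mpr hDW
      rw [e1] at h1
      have e2 : 4 * D / d = 2 * D / d + 2 * D / d := by ring
      linarith
    have hM1 : 7 / 2 * h + 7 / 2 * R + 1 ≤ 79 / 20 * D := by rw [hhD]; linarith
    have step1 : (K : ℝ) * C ≤ 4 * D / d * (16 * (r + D) / D) :=
      mul_le_mul hK4 hCle hC0 (by positivity)
    have step2 : (7 / 2 * h + 7 / 2 * R + 1) * (5 / 2 * D + 1) * (15 / 4 * R + 1) ≤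
        79 / 20 * D * (13 / 5 * D) * (19 / 4 * R) :=
      mul_le_mul (mul_le_mul hM1 h52 (by positivity) (by positivity)) h154 (by positivity)
        (by positivity)
    calc (K : ℝ) * C * ((7 / 2 * h + 7 / 2 * R + 1) * (5 / 2 * D + 1) * (15 / 4 * R + 1))
        ≤ 4 * D / d * (16 * (r + D) / D) * (79 / 20 * D * (13 / 5 * D) * (19 / 4 * R)) :=
          mul_le_mul step1 step2 hM0 (by positivity)
      _ = 4 * 16 * (79 / 20) * (13 / 5) * (19 / 4) * ((r + D) * D ^ 2 * R / d) := by
          field_simp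
      _ = 4 * 16 * (79 / 20) * (13 / 5) * (19 / 4) * ((r + D) * R ^ 2 * (L / d)) := by
          rw [hDsq]; ring
      _ ≤ 10000 * (r + D) * R ^ 2 * (L / d + 1) := by
          have hY : 0 ≤ (r + D) * R ^ 2 * (L / d) := by positivity
          nlinarith [hX, hY]

end Summit.AtomisticToContinuum.Crystallization.Theorems.LjLaminarWindowsSketch

end
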